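import Summits.QuantumFields.YangMills.Theses.DualityDefect
import HarnessLib

/-!
# Route `DualityDefect`: the support item `LaplaceRatioMonotone` (stmt-QuantumFields-11701)

THE ABSTRACT ENGINE OF THE FALL (analysis half): for finite measures `ν_P`, `ν_S` on `[0,1]` with `ν_P` charging
`(0,1]`, `ν_P(λ > a) = 0` and `ν_S(λ > a) > 0`, the moment ratio `n ↦ ∫λⁿdν_P / ∫λⁿdν_S` is eventually strictly
decreasing, in product form:
`(∫λⁿ⁺¹dν_P)(∫λⁿdν_S) < (∫λⁿdν_P)(∫λⁿ⁺¹dν_S)` for all large `n`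
(folklore «the effective mass converges to the top of the spectral support»).

Proof.  The hypotheses force `a > 0`.  Continuity from below along `Ioi a = ⋃ₖ Ioi (a + 1/(k+1))` gives a level
`a′ = a + η > a` still charged by `ν_S`, and likewise a level `δ > 0` charged by `ν_P`.  The moments
`m_P(n) = ∫λⁿdν_P ≥ δⁿ ν_P(λ > δ) > 0` and `m_S(n) ≥ 0`; `m_P(n+1) ≤ a·m_P(n)` since `λ ≤ a` `ν_P`-a.e.;
`m_S(n+1) − a·m_S(n) = ∫λⁿ(λ − a)dν_S ≥ η·a′ⁿ·ν_S(λ > a′) − aⁿ⁺¹·ν_S(ℝ)`; since `(a/a′)ⁿ → 0` the last quantity is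
eventually positive, and then `m_P(n+1)·m_S(n) ≤ a·m_P(n)·m_S(n) < m_P(n)·m_S(n+1)`.
Pure measure theory over Mathlib; nothing is asserted about Yang–Mills; no summit, leg or crux statement is proved
(width seat ym-t4-w17 g0, free hands; the item carried four unlanded candidate proofs of 2026-08-15 by grounder
seats g22-11, g22-21, g22-49 and refuter g41-12 — re-derived here, their files being unreadable from this seat).
-/

set_option autoImplicit false

namespace Summit.QuantumFields.YangMills.Theorems

namespace LaplaceRatioMonotone

open MeasureTheory Set Filter Topology

variable (ν : Measure ℝ) [IsFiniteMeasure ν]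

omit [IsFiniteMeasure ν] in
/-- A finite measure on `ℝ` vanishing off `[0,1]` lives a.e. in `[0,1]`. [folklore] -/
theorem ae_mem_Icc (h : ν (Icc (0 : ℝ) 1)ᶜ = 0) : ∀ᵐ x ∂ν, x ∈ Icc (0 : ℝ) 1 :=
  (measure_eq_zero_iff_ae_notMem.mp h).mono fun x hx => by simpa using hx

/-- Monomials are integrable against a finite measure carried by `[0,1]`. [folklore] -/
theorem integrable_pow (h : ν (Icc (0 : ℝ) 1)ᶜ = 0) (n : ℕ) : Integrable (fun x : ℝ => x ^ n) ν := by
  refine Integrable.mono' (integrable_const (1 : ℝ)) (continuous_pow n).aestronglyMeasurable ?_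
  filter_upwards [ae_mem_Icc ν h] with x hx
  rw [Real.norm_eq_abs, abs_of_nonneg (pow_nonneg hx.1 n)]
  exact pow_le_one₀ hx.1 hx.2

omit [IsFiniteMeasure ν] in
/-- Moments of a finite measure carried by `[0,1]` are non-negative. [folklore] -/
theorem integral_pow_nonneg (h : ν (Icc (0 : ℝ) 1)ᶜ = 0) (n : ℕ) : 0 ≤ ∫ x, x ^ n ∂ν :=
  integral_nonneg_of_ae ((ae_mem_Icc ν h).mono fun _ hx => pow_nonneg hx.1 n)

omit [IsFiniteMeasure ν] in
/-- **Continuity from below at an open half-line**: if `ν(λ > a) > 0` then some strictly higher level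
`a + η`, `η > 0`, is still charged. [folklore] -/
theorem exists_pos_measure_Ioi_add (a : ℝ) (ha : 0 < ν (Ioi a)) : ∃ η : ℝ, 0 < η ∧ 0 < ν (Ioi (a + η)) := by
  by_contra hcon
  push Not at hcon
  have hU : Ioi a = ⋃ k : ℕ, Ioi (a + 1 / ((k : ℝ) + 1)) := by
    ext x
    simp only [mem_Ioi, mem_iUnion]
    constructor
    · intro hx
      obtain ⟨k, hk⟩ := exists_nat_one_div_lt (sub_pos.mpr hx)
      exact ⟨k, by linarith⟩
    · rintro ⟨k, hk⟩
      have : 0 < 1 / ((k : ℝ) + 1) := by positivity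
      linarith
  have h0 : ν (Ioi a) = 0 := by
    rw [hU]
    exact measure_iUnion_null fun k => nonpos_iff_eq_zero.mp (hcon _ (by positivity))
  exact ha.ne' h0

/-- Lower bound of a moment by one charged level: `cⁿ · ν(λ > c) ≤ ∫λⁿdν` for `c ≥ 0`. [folklore] -/
theorem pow_mul_measureReal_le_integral_pow (h : ν (Icc (0 : ℝ) 1)ᶜ = 0) {c : ℝ} (hc : 0 ≤ c) (n : ℕ) :
    c ^ n * ν.real (Ioi c) ≤ ∫ x, x ^ n ∂ν := by
  have hind : ∫ x, (Ioi c).indicator (fun _ => c ^ n) x ∂ν = c ^ n * ν.real (Ioi c) := by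
    rw [integral_indicator measurableSet_Ioi, setIntegral_const, smul_eq_mul, mul_comm]
  rw [← hind]
  refine integral_mono_ae ((integrable_const _).indicator measurableSet_Ioi) (integrable_pow ν h n) ?_
  filter_upwards [ae_mem_Icc ν h] with x hx
  by_cases hxc : x ∈ Ioi c
  · rw [indicator_of_mem hxc]
    exact pow_le_pow_left₀ hc (le_of_lt hxc) n
  · rw [indicator_of_notMem hxc]
    exact pow_nonneg hx.1 n

end LaplaceRatioMonotone

open MeasureTheory Set Filter Topology in
/-- **Eventual strict monotonicity of the moment ratio** (product form): for finite measures `ν_P`, `ν_S` carried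
by `[0,1]` with `ν_P(λ > 0) > 0`, `ν_P(λ > a) = 0` and `ν_S(λ > a) > 0`, eventually
`(∫λⁿ⁺¹dν_P)(∫λⁿdν_S) < (∫λⁿdν_P)(∫λⁿ⁺¹dν_S)`. [folklore] -/
theorem moment_ratio_eventually_lt (νP νS : Measure ℝ) [IsFiniteMeasure νP] [IsFiniteMeasure νS] (a : ℝ)
    (hP : νP (Icc (0 : ℝ) 1)ᶜ = 0) (hS : νS (Icc (0 : ℝ) 1)ᶜ = 0) (hP0 : 0 < νP (Ioi 0))
    (hPa : νP (Ioi a) = 0) (hSa : 0 < νS (Ioi a)) :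
    ∃ n₀ : ℕ, ∀ n : ℕ, n₀ ≤ n →
      (∫ x, x ^ (n + 1) ∂νP) * (∫ x, x ^ n ∂νS) < (∫ x, x ^ n ∂νP) * (∫ x, x ^ (n + 1) ∂νS) := by
  -- `a > 0`
  have ha : 0 < a := by
    by_contra h
    push Not at h
    have : νP (Ioi 0) ≤ νP (Ioi a) := measure_mono (Ioi_subset_Ioi h)
    rw [hPa] at this
    exact hP0.ne' (nonpos_iff_eq_zero.mp this)
  -- charged levels `a' = a + η` for `ν_S` and `δ` for `ν_P`
  obtain ⟨η, hη, hSη⟩ := LaplaceRatioMonotone.exists_pos_measure_Ioi_add νS a hSa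
  obtain ⟨δ, hδ, hPδ⟩ := LaplaceRatioMonotone.exists_pos_measure_Ioi_add νP 0 hP0
  rw [zero_add] at hPδ
  set a' : ℝ := a + η with ha'def
  have ha' : 0 < a' := by positivity
  have hSη' : 0 < νS.real (Ioi a') := ENNReal.toReal_pos hSη.ne' (measure_ne_top νS _)
  have hPδ' : 0 < νP.real (Ioi δ) := ENNReal.toReal_pos hPδ.ne' (measure_ne_top νP _)
  -- notation for the moments
  set mP : ℕ → ℝ := fun n => ∫ x, x ^ n ∂νP with hmP
  set mS : ℕ → ℝ := fun n => ∫ x, x ^ n ∂νS with hmS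
  -- `m_P(n) > 0`, `m_S(n) ≥ 0`
  have hmP_pos : ∀ n, 0 < mP n := fun n =>
    lt_of_lt_of_le (mul_pos (pow_pos hδ n) hPδ')
      (LaplaceRatioMonotone.pow_mul_measureReal_le_integral_pow νP hP hδ.le n)
  have hmS_nonneg : ∀ n, 0 ≤ mS n := fun n => LaplaceRatioMonotone.integral_pow_nonneg νS hS n
  -- `m_P(n+1) ≤ a · m_P(n)`
  have haeP : ∀ᵐ x ∂νP, x ≤ a := (measure_eq_zero_iff_ae_notMem.mp hPa).mono fun x hx => not_lt.mp hx
  have hstepP : ∀ n, mP (n + 1) ≤ a * mP n := fun n => by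
    simp only [hmP]
    rw [← integral_const_mul]
    refine integral_mono_ae (LaplaceRatioMonotone.integrable_pow νP hP (n + 1))
      ((LaplaceRatioMonotone.integrable_pow νP hP n).const_mul a) ?_
    filter_upwards [LaplaceRatioMonotone.ae_mem_Icc νP hP, haeP] with x hx hxa
    rw [pow_succ]
    exact mul_le_mul_of_nonneg_left hxa (pow_nonneg hx.1 n) |>.trans_eq (mul_comm _ _)
  -- `m_S(n+1) − a·m_S(n) ≥ η·a'ⁿ·ν_S(λ > a') − aⁿ⁺¹·ν_S(ℝ)`
  have hstepS : ∀ n, η * a' ^ n * νS.real (Ioi a') - a ^ (n + 1) * νS.real univ ≤ mS (n + 1) - a * mS n :=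
      fun n => by
    simp only [hmS]
    have hI1 := LaplaceRatioMonotone.integrable_pow νS hS (n + 1)
    have hI0 := LaplaceRatioMonotone.integrable_pow νS hS n
    -- the test function `g = η a'ⁿ 1_{λ > a'} − aⁿ⁺¹`
    have hg : Integrable (fun x => (Ioi a').indicator (fun _ => η * a' ^ n) x - a ^ (n + 1)) νS :=
      ((integrable_const _).indicator measurableSet_Ioi).sub (integrable_const _)
    have hgint : ∫ x, ((Ioi a').indicator (fun _ => η * a' ^ n) x - a ^ (n + 1)) ∂νS
        = η * a' ^ n * νS.real (Ioi a') - a ^ (n + 1) * νS.real univ := by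
      rw [integral_sub ((integrable_const _).indicator measurableSet_Ioi) (integrable_const _),
        integral_indicator measurableSet_Ioi, setIntegral_const, integral_const, smul_eq_mul, smul_eq_mul]
      ring
    have hdiff : ∫ x, x ^ (n + 1) ∂νS - a * ∫ x, x ^ n ∂νS = ∫ x, (x ^ (n + 1) - a * x ^ n) ∂νS := by
      rw [← integral_const_mul, ← integral_sub hI1 (hI0.const_mul a)]
    rw [hdiff, ← hgint]
    refine integral_mono_ae hg (hI1.sub (hI0.const_mul a)) ?_
    filter_upwards [LaplaceRatioMonotone.ae_mem_Icc νS hS] with x hx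
    have hxn : 0 ≤ x ^ n := pow_nonneg hx.1 n
    have hfac : x ^ (n + 1) - a * x ^ n = x ^ n * (x - a) := by ring
    rw [hfac]
    by_cases hxa' : x ∈ Ioi a'
    · rw [indicator_of_mem hxa']
      have hx1 : a' ^ n ≤ x ^ n := pow_le_pow_left₀ ha'.le (le_of_lt hxa') n
      have hx2 : η ≤ x - a := by simp only [mem_Ioi, ha'def] at hxa'; linarith
      have : η * a' ^ n ≤ x ^ n * (x - a) := by
        calc η * a' ^ n = a' ^ n * η := mul_comm _ _
          _ ≤ x ^ n * (x - a) := mul_le_mul hx1 hx2 hη.le hxn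
      linarith [pow_nonneg ha.le (n + 1)]
    · rw [indicator_of_notMem hxa', zero_sub]
      -- `xⁿ (x − a) ≥ −a·xⁿ ≥ −aⁿ⁺¹` when `x ≤ a`, and `≥ 0` when `x ≥ a`
      by_cases hxa : a ≤ x
      · have : 0 ≤ x ^ n * (x - a) := mul_nonneg hxn (sub_nonneg.mpr hxa)
        linarith [pow_nonneg ha.le (n + 1)]
      · push Not at hxa
        have hx3 : x ^ n ≤ a ^ n := pow_le_pow_left₀ hx.1 hxa.le n
        have hx4 : -a ≤ x - a := by linarith [hx.1]
        calc -a ^ (n + 1) = a ^ n * (-a) := by ring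
          _ ≤ x ^ n * (-a) := by nlinarith
          _ ≤ x ^ n * (x - a) := mul_le_mul_of_nonneg_left hx4 hxn
  -- `(a/a')ⁿ → 0`: eventually `aⁿ⁺¹·ν_S(ℝ) < η·a'ⁿ·ν_S(λ > a')`
  have hratio : a / a' < 1 := by rw [div_lt_one ha']; simp only [ha'def]; linarith
  have hlim : Tendsto (fun n : ℕ => (a / a') ^ n * (a * νS.real univ)) atTop (𝓝 (0 * (a * νS.real univ))) :=
    (tendsto_pow_atTop_nhds_zero_of_lt_one (div_nonneg ha.le ha'.le) hratio).mul_const _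
  rw [zero_mul] at hlim
  have hev : ∀ᶠ n : ℕ in atTop, (a / a') ^ n * (a * νS.real univ) < η * νS.real (Ioi a') :=
    hlim.eventually (gt_mem_nhds (mul_pos hη hSη'))
  obtain ⟨n₀, hn₀⟩ := eventually_atTop.mp hev
  refine ⟨n₀, fun n hn => ?_⟩
  have hkey : 0 < η * a' ^ n * νS.real (Ioi a') - a ^ (n + 1) * νS.real univ := by
    have h1 := hn₀ n hn
    have ha'n : 0 < a' ^ n := pow_pos ha' n
    -- multiply `h1` by `a'ⁿ`
    have h2 : (a / a') ^ n * (a * νS.real univ) * a' ^ n < η * νS.real (Ioi a') * a' ^ n :=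
      mul_lt_mul_of_pos_right h1 ha'n
    have h3 : (a / a') ^ n * a' ^ n = a ^ n := by
      rw [div_pow, div_mul_cancel₀ _ ha'n.ne']
    have h4 : (a / a') ^ n * (a * νS.real univ) * a' ^ n = a ^ (n + 1) * νS.real univ := by
      calc (a / a') ^ n * (a * νS.real univ) * a' ^ n = ((a / a') ^ n * a' ^ n) * (a * νS.real univ) := by ring
        _ = a ^ n * (a * νS.real univ) := by rw [h3]
        _ = a ^ (n + 1) * νS.real univ := by ring
    have h5 : η * νS.real (Ioi a') * a' ^ n = η * a' ^ n * νS.real (Ioi a') := by ring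
    rw [h4, h5] at h2
    linarith
  -- conclude
  have hS1 : a * mS n + (η * a' ^ n * νS.real (Ioi a') - a ^ (n + 1) * νS.real univ) ≤ mS (n + 1) := by
    linarith [hstepS n]
  calc mP (n + 1) * mS n ≤ a * mP n * mS n := mul_le_mul_of_nonneg_right (hstepP n) (hmS_nonneg n)
    _ = mP n * (a * mS n) := by ring
    _ < mP n * mS (n + 1) := by
        refine mul_lt_mul_of_pos_left ?_ (hmP_pos n)
        linarith

/-- **Item stmt-QuantumFields-11701 `DualityDefect.LaplaceRatioMonotone` holds.** [folklore] -/
theorem dualityDefect_laplaceRatioMonotone_proof :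
    Summit.QuantumFields.YangMills.Theses.DualityDefect.LaplaceRatioMonotone := by
  unfold Summit.QuantumFields.YangMills.Theses.DualityDefect.LaplaceRatioMonotone
  intro νP νS _ _ a hP hS hP0 hPa hSa
  exact moment_ratio_eventually_lt νP νS a hP hS hP0 hPa hSa

end Summit.QuantumFields.YangMills.Theorems
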